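import Summits.Ventures.LatticeQCDFlow.Scaling.ConveyorPoincare
import Summits.Ventures.LatticeQCDFlow.Scaling.ConveyorPoincareHeating
import Summits.Ventures.LatticeQCDFlow.Scaling.ReplicaExchangeBareSampler
import Summits.Ventures.LatticeQCDFlow.Scaling.SpectralGapOfPoincare

/-!
HONEST FRAMING: exact (Metropolis-corrected) sampling algorithms for lattice gauge theory; figures
of merit are autocorrelation/cost numbers at stated couplings and volumes; no continuum-physics
claim.

# ReplicaExchangeFrozenColdDirect — WITH ARBITRARY (EVEN FROZEN) COLD UPDATES THE TAGLESS SAMPLER *IS* A CONVEYOR: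
# THE CONVEYOR POINCARÉ INEQUALITY APPLIES TO IT DIRECTLY, WITHOUT A DECOMPOSITION STEP, GIVING
# `Gap(ptBareSampler t μ M) ≥ p q^K·min{t/(6K²(K+1)), γ₀(1−t)/(6(K+1)²)}` (cooling form) AND
# `≥ p·min{t/(16K²(K+1)Π_l M_l), γ₀(1−t)/(16(K+1)²)}` (growth form) — A FACTOR `8(K+1)` ABOVE CHAPTER R's
# `ReplicaExchangeFrozenCold`, AND WITH THE DIFFUSIVE CEILING THE FROZEN-COLD RELAXATION TIME IS `Θ(K³)`
# (lean-2 GEN-19, ours)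

Venture-side (OURS).  Cell `lqcd-flow` (pub-lqcd), unit `pub-lqcd-lean-2-g19`, 2026-08-25.  Chapter R.  Setting of
`Scaling/ReplicaExchangeBareSampler`: the tagless sampler `P = ptBareSampler t μ M` on `Fin (K+1) → S`.  Chapter R's
floor for ARBITRARY cold updates (`Scaling/ReplicaExchangeFrozenCold`, via the mode decomposition with `mode = id`
and Jerrum–Son–Tetali–Vigoda) pays the product of the projection constant with the restriction gap `(1−t)/(K+1)`,
although with `mode = id` the blocks are SINGLETONS and the projection chain is `P` itself.  Here the conveyor
Poincaré inequalities of `Scaling/ConveyorPoincare` (C3, displacement by cooling `q`) and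
`Scaling/ConveyorPoincareHeating` (C5b, rotation paths, levelwise growth `M_l`) are applied to `P` DIRECTLY: its
transposition flows are `≥ (t/K)·min` and its hot relabel flows dominate `((1−t)/(K+1))×` the hot update `M_0`
(`Scaling/ReplicaExchangeBareSampler`, §2), whatever the cold updates `M_k`, `k ≥ 1`, are.

## What is proved

* (§1 = `Scaling/SpectralGapOfPoincare.le_spectralGap_of_poincare`, the Poincaré-to-gap bridge.)
* §2 **`ptBareDirect_poincare_of_cooling`** / **`ptBareDirect_spectralGap_ge_of_cooling`** —
  `Gap(P) ≥ min{p q^K t/(6K²(K+1)), p q^K γ₀(1−t)/(6(K+1)²)}` from persistence `p`, one-level cooling `q`, the hot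
  update's Poincaré constant `γ₀`, `0 < t < 1`, `K ≥ 1`, ARBITRARY `μ_k`-reversible cold updates;
  **`ptBareDirect_spectralGap_ge_of_levelGrowth`** — `Gap(P) ≥ min{p t/(16K²(K+1)Π_l M_l), p γ₀(1−t)/(16(K+1)²)}` from
  levelwise growth bounds `μ_{l+1} ≤ M_l μ_l` (`M_l ≥ 1`; labels that only decay coldward do not enter).
* §3 **`ptBareIdentical_spectralGap_ge`** — identical levels (`μ_k = μ_0`): `Gap ≥ min{t/(6K²(K+1)), γ₀(1−t)/(6(K+1)²)}`;
  with `Scaling/ReplicaExchangeDiffusiveTauInt.ptBareIdenticalFrozen_spectralGap_le` (`Gap ≤ 6t/(K(K+1)(2K+1))` when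
  the cold replicas are sector-frozen) the relaxation time of replica exchange over frozen cold replicas is PINNED:
  `K(K+1)(2K+1)/(6t) ≤ t_rel ≤ max{6K²(K+1)/t, 6(K+1)²/(γ₀(1−t))}` — order `K³` exactly when the hot replica is not
  the bottleneck.

NOT CLAIMED: the `τ_int` / mixing corollaries (pattern of `ReplicaExchangeFrozenCold` §3, routine); modes finer than
singletons (that is `ReplicaExchangeModeGap`, where the restriction gap is genuinely needed); anything measured.
Literature grade (cell rule): OWN MECHANISM (chapter C) applied without loss; NEW TYPING; nothing cited as a fact;
no new bib keys.
-/

noncomputable section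

open Finset Function
open Literature.Probability.MarkovChains

namespace Summit.Ventures.LatticeQCDFlow.Scaling

/-! ## §2 The conveyor inequalities applied to the sampler itself -/

section Direct

variable {S : Type*} [Fintype S] [DecidableEq S] {K : ℕ} {μ : Fin (K + 1) → S → ℝ}
  {M : Fin (K + 1) → S → S → ℝ} {t : ℝ}

/-- **The conveyor Poincaré inequality (cooling form) for the sampler itself:** persistence `p`, one-level cooling
`q`, hot Poincaré constant `γ₀`, `0 < t ≤ 1`, `K ≥ 1` ⇒ `C·Var_π̃(f) ≤ 𝓔_π̃(P; f)` whenever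
`C·6K(K+1) ≤ p q^K t/K` and `C·6(K+1) ≤ p q^K γ₀ (1−t)/(K+1)`. [ours] -/
theorem ptBareDirect_poincare_of_cooling (hK : 1 ≤ K) (hμ : ∀ k x, 0 < μ k x) (hμ1 : ∀ k, ∑ u, μ k u = 1)
    (hM : ∀ k, IsRowStochastic (M k)) (ht0 : 0 < t) (ht1 : t < 1) {p q γ₀ : ℝ} (hp : 0 < p) (hq0 : 0 < q)
    (hq1 : q ≤ 1) (hγ₀ : 0 < γ₀) (hpers : ∀ (i k : Fin (K + 1)) (u : S), i ≤ k → p * μ k u ≤ μ i u)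
    (hq : ∀ (l : Fin K) (u : S), q * μ l.castSucc u ≤ μ l.succ u)
    (hgap0 : ∀ h : S → ℝ, γ₀ * lawVariance (μ 0) h ≤ dirichletForm (μ 0) (M 0) h)
    (f : (Fin (K + 1) → S) → ℝ) {C : ℝ} (hC0 : 0 ≤ C) (hC1 : C * (6 * K * (K + 1)) ≤ p * q ^ K * (t / K))
    (hC2 : C * (6 * (K + 1)) ≤ p * q ^ K * γ₀ * ((1 - t) / (K + 1))) :
    C * lawVariance (tensorFun μ) f ≤ dirichletForm (tensorFun μ) (ptBareSampler t μ M) f := by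
  have hKpos : (0 : ℝ) < K := Nat.cast_pos.mpr (by omega)
  exact conveyor_poincare_of_cooling (ν := μ) (Q := ptBareSampler t μ M) (fun k u => (hμ k u).le) hμ1 hp hq0 hq1
    (div_pos ht0 hKpos) hγ₀ (div_pos (by linarith) (by positivity)) hpers hq
    (ptBareSampler_nonneg hμ hM ht0.le ht1.le)
    (fun z l _ => tensorFun_mul_ptBareSampler_swap_ge hμ hM ht0.le ht1.le z l) hgap0
    (fun z v hv => tensorFun_mul_ptBareSampler_update_ge hμ ht0.le z 0 hv) f hC0 hC1 hC2

/-- **THE DIRECT FLOOR (cooling form): `Gap(ptBareSampler t μ M) ≥ min{p q^K t/(6K²(K+1)), p q^K γ₀(1−t)/(6(K+1)²)}`**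
for ARBITRARY `μ_k`-reversible cold updates (`K ≥ 1`, `0 < t < 1`, `|S| ≥ 2`). [ours] -/
theorem ptBareDirect_spectralGap_ge_of_cooling [Nontrivial S] (hK : 1 ≤ K) (hμ : ∀ k x, 0 < μ k x)
    (hμ1 : ∀ k, ∑ u, μ k u = 1) (hM : ∀ k, IsRowStochastic (M k)) (hMrev : ∀ k, DetailedBalance (μ k) (M k))
    (ht0 : 0 < t) (ht1 : t < 1) {p q γ₀ : ℝ} (hp : 0 < p) (hq0 : 0 < q) (hq1 : q ≤ 1) (hγ₀ : 0 < γ₀)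
    (hpers : ∀ (i k : Fin (K + 1)) (u : S), i ≤ k → p * μ k u ≤ μ i u)
    (hq : ∀ (l : Fin K) (u : S), q * μ l.castSucc u ≤ μ l.succ u)
    (hgap0 : ∀ h : S → ℝ, γ₀ * lawVariance (μ 0) h ≤ dirichletForm (μ 0) (M 0) h) :
    min (p * q ^ K * t / (6 * K ^ 2 * (K + 1))) (p * q ^ K * γ₀ * (1 - t) / (6 * (K + 1) ^ 2))
      ≤ spectralGap (tensorFun μ) (ptBareSampler t μ M) := by
  have hKpos : (0 : ℝ) < K := Nat.cast_pos.mpr (by omega)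
  have hpqK : 0 < p * q ^ K := mul_pos hp (pow_pos hq0 K)
  set C := min (p * q ^ K * t / (6 * K ^ 2 * (K + 1))) (p * q ^ K * γ₀ * (1 - t) / (6 * (K + 1) ^ 2)) with hC
  have hC0 : 0 ≤ C :=
    le_min (by positivity) (div_nonneg (mul_nonneg (mul_nonneg hpqK.le hγ₀.le) (by linarith)) (by positivity))
  refine le_spectralGap_of_poincare (tensorFun_pos hμ) (sum_tensorFun_eq_one μ hμ1)
    (ptBareSampler_isRowStochastic hμ hM ht0.le ht1.le) (ptBareSampler_detailedBalance hμ hMrev) fun f => ?_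
  refine ptBareDirect_poincare_of_cooling hK hμ hμ1 hM ht0 ht1 hp hq0 hq1 hγ₀ hpers hq hgap0 f hC0 ?_ ?_
  · calc C * (6 * K * (K + 1)) ≤ p * q ^ K * t / (6 * K ^ 2 * (K + 1)) * (6 * K * (K + 1)) :=
        mul_le_mul_of_nonneg_right (min_le_left _ _) (by positivity)
      _ = p * q ^ K * (t / K) := by field_simp
  · calc C * (6 * (K + 1)) ≤ p * q ^ K * γ₀ * (1 - t) / (6 * (K + 1) ^ 2) * (6 * (K + 1)) :=
        mul_le_mul_of_nonneg_right (min_le_right _ _) (by positivity)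
      _ = p * q ^ K * γ₀ * ((1 - t) / (K + 1)) := by field_simp

/-- **THE DIRECT FLOOR (growth form, no cooling factor):**
`Gap(ptBareSampler t μ M) ≥ min{p t/(16K²(K+1)·Π_l M_l), p γ₀(1−t)/(16(K+1)²)}` from persistence `p` and LEVELWISE
GROWTH bounds `μ_{l+1}(u) ≤ M_l μ_l(u)` (`M_l ≥ 1`), arbitrary cold updates. [ours] -/
theorem ptBareDirect_spectralGap_ge_of_levelGrowth [Nontrivial S] (hK : 1 ≤ K) (hμ : ∀ k x, 0 < μ k x)
    (hμ1 : ∀ k, ∑ u, μ k u = 1) (hM : ∀ k, IsRowStochastic (M k)) (hMrev : ∀ k, DetailedBalance (μ k) (M k))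
    (ht0 : 0 < t) (ht1 : t < 1) {p γ₀ : ℝ} {Mg : Fin K → ℝ} (hp : 0 < p) (hM1 : ∀ l, 1 ≤ Mg l) (hγ₀ : 0 < γ₀)
    (hpers : ∀ (i k : Fin (K + 1)) (u : S), i ≤ k → p * μ k u ≤ μ i u)
    (hgrow : ∀ (l : Fin K) (u : S), μ l.succ u ≤ Mg l * μ l.castSucc u)
    (hgap0 : ∀ h : S → ℝ, γ₀ * lawVariance (μ 0) h ≤ dirichletForm (μ 0) (M 0) h) :
    min (p * t / (16 * K ^ 2 * (K + 1) * ∏ l, Mg l)) (p * γ₀ * (1 - t) / (16 * (K + 1) ^ 2))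
      ≤ spectralGap (tensorFun μ) (ptBareSampler t μ M) := by
  have hKpos : (0 : ℝ) < K := Nat.cast_pos.mpr (by omega)
  have hprod : 0 < ∏ l, Mg l := prod_pos fun l _ => lt_of_lt_of_le one_pos (hM1 l)
  set C := min (p * t / (16 * K ^ 2 * (K + 1) * ∏ l, Mg l)) (p * γ₀ * (1 - t) / (16 * (K + 1) ^ 2)) with hC
  have hC0 : 0 ≤ C :=
    le_min (by positivity) (div_nonneg (mul_nonneg (mul_nonneg hp.le hγ₀.le) (by linarith)) (by positivity))
  refine le_spectralGap_of_poincare (tensorFun_pos hμ) (sum_tensorFun_eq_one μ hμ1)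
    (ptBareSampler_isRowStochastic hμ hM ht0.le ht1.le) (ptBareSampler_detailedBalance hμ hMrev) fun f => ?_
  refine conveyor_poincare_of_levelGrowth (ν := μ) (Q := ptBareSampler t μ M) (fun k u => (hμ k u).le) hμ1 hp hM1
    (div_pos ht0 hKpos) hγ₀ (div_pos (by linarith) (by positivity : (0 : ℝ) < K + 1)) hpers hgrow
    (ptBareSampler_nonneg hμ hM ht0.le ht1.le)
    (fun z l _ => tensorFun_mul_ptBareSampler_swap_ge hμ hM ht0.le ht1.le z l) hgap0
    (fun z v hv => tensorFun_mul_ptBareSampler_update_ge hμ ht0.le z 0 hv) f hC0 ?_ ?_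
  · calc C * (16 * K * (K + 1) * ∏ l, Mg l) ≤ p * t / (16 * K ^ 2 * (K + 1) * ∏ l, Mg l) * (16 * K * (K + 1) * ∏ l, Mg l) :=
        mul_le_mul_of_nonneg_right (min_le_left _ _) (by positivity)
      _ = p * (t / K) := by field_simp
  · calc C * (16 * (K + 1)) ≤ p * γ₀ * (1 - t) / (16 * (K + 1) ^ 2) * (16 * (K + 1)) :=
        mul_le_mul_of_nonneg_right (min_le_right _ _) (by positivity)
      _ = p * γ₀ * ((1 - t) / (K + 1)) := by field_simp

/-! ## §3 Identical levels: the frozen-cold relaxation time is `Θ(K³)` -/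

/-- **IDENTICAL LEVELS, ARBITRARY COLD UPDATES: `Gap(ptBareSampler t μ M) ≥ min{t/(6K²(K+1)), γ₀(1−t)/(6(K+1)²)}`**
(`μ_k = μ_0` for all `k`; the hot update `M_0` has Poincaré constant `γ₀`; `K ≥ 1`, `0 < t < 1`).  With the
ceiling `6t/(K(K+1)(2K+1))` of `Scaling/ReplicaExchangeDiffusiveTauInt` (cold replicas sector-frozen) this pins the
relaxation time between `K(K+1)(2K+1)/(6t)` and `max{6K²(K+1)/t, 6(K+1)²/(γ₀(1−t))}`. [ours] -/
theorem ptBareIdentical_spectralGap_ge [Nontrivial S] (hK : 1 ≤ K) (hμ : ∀ k x, 0 < μ k x)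
    (hμ1 : ∀ k, ∑ u, μ k u = 1) (hM : ∀ k, IsRowStochastic (M k)) (hMrev : ∀ k, DetailedBalance (μ k) (M k))
    (ht0 : 0 < t) (ht1 : t < 1) (hsame : ∀ k, μ k = μ 0) {γ₀ : ℝ} (hγ₀ : 0 < γ₀)
    (hgap0 : ∀ h : S → ℝ, γ₀ * lawVariance (μ 0) h ≤ dirichletForm (μ 0) (M 0) h) :
    min (t / (6 * K ^ 2 * (K + 1))) (γ₀ * (1 - t) / (6 * (K + 1) ^ 2))
      ≤ spectralGap (tensorFun μ) (ptBareSampler t μ M) := by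
  have h := ptBareDirect_spectralGap_ge_of_cooling (p := 1) (q := 1) hK hμ hμ1 hM hMrev ht0 ht1 one_pos one_pos
    le_rfl hγ₀ (fun i k u _ => by rw [hsame k, hsame i, one_mul]) (fun l u => by rw [hsame, hsame l.succ, one_mul])
    hgap0
  simpa using h

end Direct

end Summit.Ventures.LatticeQCDFlow.Scaling

end
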